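import Mathlib.Algebra.Homology.Bifunctor
import Literature.Algebra.Homology.TotalComplexMapFunctor
import HarnessLib

/-!
# `mapBifunctor` from term data: an isomorphism `F'(K₁', K₂') ≅ H•F(K₁, K₂)` of total complexes from compatible
# isomorphisms of the terms `F'(K₁'ⁱ, K₂'ʲ) ≅ H(F(K₁ⁱ, K₂ʲ))`

Mathlib's `HomologicalComplex.mapBifunctor K₁ K₂ F c` (the total complex of the bicomplex `(i, j) ↦ F(K₁ⁱ, K₂ʲ)`, Mathlib
`Functor.mapBifunctorHomologicalComplex` + `HomologicalComplex₂.total`) is functorial in `K₁`, `K₂` (`mapBifunctorMap`) but Mathlib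
records no variance in the bifunctor `F`, nor the exchange of the total complex with a functor applied to the target category. This
file PROVES (0 named facts, no instances) the bookkeeping lemma both reduce to: given complexes `K₁`, `K₂`, `K₁'`, `K₂'`, bifunctors
`F : C₁ ⥤ C₂ ⥤ C`, `F' : C₁' ⥤ C₂' ⥤ D`, an additive functor `H : C ⥤ D`, and isomorphisms of TERMS
`η i j : F'(K₁'ⁱ, K₂'ʲ) ≅ H(F(K₁ⁱ, K₂ʲ))` compatible with the differentials of `K₁`/`K₁'` and of `K₂`/`K₂'`,

* `mapBifunctorHomologicalComplexIsoOfComponents` — the isomorphism of BICOMPLEXES `F'(K₁', K₂') ≅ H••F(K₁, K₂)`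
  (`HomologicalComplex.Hom.isoOfComponents` twice);
* **`mapBifunctorIsoOfComponents : mapBifunctor K₁' K₂' F' c ≅ H•(mapBifunctor K₁ K₂ F c)`** when `H` preserves the coproducts of the
  total complex (`HomologicalComplex₂.total.mapIso` + the tree's `TotalComplexMapFunctor.mapTotalIso`), with the summand formula
  `ιMapBifunctor_mapBifunctorIsoOfComponents_hom : ι'_{ij} ≫ iso = η_{ij} ≫ H(ι_{ij})`.

Typical use (`AlgebraicGeometry/Modules/BoxTensorComplexBaseChange`): `K₁' = u^*•K₁`, `K₂' = N ⊗ •K₂`, `F = F' = ⊠`, `H = g^* ∘ (q^*N ⊗ –)`,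
`η` = the termwise base-change ∕ twist isomorphisms of vector bundles. Pure bookkeeping over Mathlib; typed for the cell `pub-hodge-ring2`
(chain-level box compatibility feeding the `e₂ ↦ e₁` bridge of crux 26512's sockets; a research route conditional on HC_CM, not a
corollary — nothing here refers to it).

## References

* C. A. Weibel, *An introduction to homological algebra* (1994), §1.2 (double and total complexes, 1.2.6), §2.6 (additive functors). [Weibel1994]
* The Stacks Project, Tag 012Z (Definition 12.18.3, total complex). [StacksProject]
-/

noncomputable section

-- `GradedObject`/`HomologicalComplex₂.toGradedObject` are not reducible (as in Mathlib's `Algebra/Homology/TotalComplex.lean`).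
set_option backward.isDefEq.respectTransparency false

open CategoryTheory CategoryTheory.Category CategoryTheory.Limits

universe v₁ v₂ v₃ v₄ v₅ v₆ u₁ u₂ u₃ u₄ u₅ u₆ w₁ w₂ w₃

namespace Literature.Algebra.Homology

variable {C₁ : Type u₁} [Category.{v₁} C₁] [HasZeroMorphisms C₁] {C₂ : Type u₂} [Category.{v₂} C₂] [HasZeroMorphisms C₂]
  {C : Type u₃} [Category.{v₃} C] [Preadditive C]
  {C₁' : Type u₄} [Category.{v₄} C₁'] [HasZeroMorphisms C₁'] {C₂' : Type u₅} [Category.{v₅} C₂'] [HasZeroMorphisms C₂']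
  {D : Type u₆} [Category.{v₆} D] [Preadditive D]
  {I₁ : Type w₁} {I₂ : Type w₂} {J : Type w₃} {c₁ : ComplexShape I₁} {c₂ : ComplexShape I₂}
  (K₁ : HomologicalComplex C₁ c₁) (K₂ : HomologicalComplex C₂ c₂) (K₁' : HomologicalComplex C₁' c₁) (K₂' : HomologicalComplex C₂' c₂)
  (F : C₁ ⥤ C₂ ⥤ C) [F.PreservesZeroMorphisms] [∀ X, (F.obj X).PreservesZeroMorphisms]
  (F' : C₁' ⥤ C₂' ⥤ D) [F'.PreservesZeroMorphisms] [∀ X, (F'.obj X).PreservesZeroMorphisms]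
  (H : C ⥤ D) [H.Additive]
  (η : ∀ (i₁ : I₁) (i₂ : I₂), (F'.obj (K₁'.X i₁)).obj (K₂'.X i₂) ≅ H.obj ((F.obj (K₁.X i₁)).obj (K₂.X i₂)))
  (hη₁ : ∀ (i₁ i₁' : I₁) (i₂ : I₂), (F'.map (K₁'.d i₁ i₁')).app (K₂'.X i₂) ≫ (η i₁' i₂).hom =
    (η i₁ i₂).hom ≫ H.map ((F.map (K₁.d i₁ i₁')).app (K₂.X i₂)))
  (hη₂ : ∀ (i₁ : I₁) (i₂ i₂' : I₂), (F'.obj (K₁'.X i₁)).map (K₂'.d i₂ i₂') ≫ (η i₁ i₂').hom =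
    (η i₁ i₂).hom ≫ H.map ((F.obj (K₁.X i₁)).map (K₂.d i₂ i₂')))

/-- **The isomorphism of bicomplexes `F'(K₁', K₂') ≅ H••F(K₁, K₂)` with components `η`** (compatibility with the two differentials
is exactly `hη₁`, `hη₂`). [cite: Weibel1994, §1.2 (double complexes) and §2.6] -/
def mapBifunctorHomologicalComplexIsoOfComponents :
    ((F'.mapBifunctorHomologicalComplex c₁ c₂).obj K₁').obj K₂' ≅
      mapBicomplex H (((F.mapBifunctorHomologicalComplex c₁ c₂).obj K₁).obj K₂) :=
  HomologicalComplex.Hom.isoOfComponents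
    (fun i₁ => HomologicalComplex.Hom.isoOfComponents (fun i₂ => η i₁ i₂) (fun i₂ i₂' _ => by
      dsimp [mapBicomplex]
      exact (hη₂ i₁ i₂ i₂').symm))
    (fun i₁ i₁' _ => by
      ext i₂
      dsimp [mapBicomplex]
      exact (hη₁ i₁ i₁' i₂).symm)

/-- The `(i₁, i₂)` component of the bicomplex isomorphism is `η i₁ i₂`. [cite: Weibel1994, §1.2] -/
@[simp]
theorem mapBifunctorHomologicalComplexIsoOfComponents_hom_f_f (i₁ : I₁) (i₂ : I₂) :
    ((mapBifunctorHomologicalComplexIsoOfComponents K₁ K₂ K₁' K₂' F F' H η hη₁ hη₂).hom.f i₁).f i₂ = (η i₁ i₂).hom := rfl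

/-- The `(i₁, i₂)` component of the inverse is `(η i₁ i₂)⁻¹`. [cite: Weibel1994, §1.2] -/
@[simp]
theorem mapBifunctorHomologicalComplexIsoOfComponents_inv_f_f (i₁ : I₁) (i₂ : I₂) :
    ((mapBifunctorHomologicalComplexIsoOfComponents K₁ K₂ K₁' K₂' F F' H η hη₁ hη₂).inv.f i₁).f i₂ = (η i₁ i₂).inv := rfl

variable (c : ComplexShape J) [TotalComplexShape c₁ c₂ c] [DecidableEq J]
  [HomologicalComplex.HasMapBifunctor K₁ K₂ F c] [HomologicalComplex.HasMapBifunctor K₁' K₂' F' c]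
  [∀ j : J, PreservesColimit (Discrete.functor
    ((((F.mapBifunctorHomologicalComplex c₁ c₂).obj K₁).obj K₂).toGradedObject.mapObjFun (ComplexShape.π c₁ c₂ c) j)) H]

include hη₁ hη₂ in
omit [DecidableEq J] [HomologicalComplex.HasMapBifunctor K₁ K₂ F c]
  [∀ j : J, PreservesColimit (Discrete.functor
    ((((F.mapBifunctorHomologicalComplex c₁ c₂).obj K₁).obj K₂).toGradedObject.mapObjFun (ComplexShape.π c₁ c₂ c) j)) H] in
/-- `H••F(K₁, K₂)` has a total complex (transported along the bicomplex isomorphism from `F'(K₁', K₂')`). [cite: Weibel1994, §1.2, 1.2.6] -/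
theorem hasTotal_mapBicomplex_of_components :
    (mapBicomplex H (((F.mapBifunctorHomologicalComplex c₁ c₂).obj K₁).obj K₂)).HasTotal c :=
  HomologicalComplex₂.hasTotal_of_iso (mapBifunctorHomologicalComplexIsoOfComponents K₁ K₂ K₁' K₂' F F' H η hη₁ hη₂) c

/-- **`mapBifunctor K₁' K₂' F' c ≅ H•(mapBifunctor K₁ K₂ F c)` from compatible term isomorphisms `η`**, for `H` additive and
preserving the coproducts `∐_{π(i₁,i₂)=j} F(K₁^{i₁}, K₂^{i₂})` of the total complex (`total.mapIso` of the bicomplex isomorphism, then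
the exchange `(H••B).total ≅ H•(B.total)`). [cite: Weibel1994, §1.2, 1.2.6 and §2.6] [cite: StacksProject, Tag 012Z] -/
def mapBifunctorIsoOfComponents :
    HomologicalComplex.mapBifunctor K₁' K₂' F' c ≅
      (H.mapHomologicalComplex c).obj (HomologicalComplex.mapBifunctor K₁ K₂ F c) :=
  haveI := hasTotal_mapBicomplex_of_components K₁ K₂ K₁' K₂' F F' H η hη₁ hη₂ c
  HomologicalComplex₂.total.mapIso (mapBifunctorHomologicalComplexIsoOfComponents K₁ K₂ K₁' K₂' F F' H η hη₁ hη₂) c ≪≫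
    mapTotalIso H (((F.mapBifunctorHomologicalComplex c₁ c₂).obj K₁).obj K₂) c

/-- **Summand formula**: on the summand `F'(K₁'^{i₁}, K₂'^{i₂}) ⟶ (F'(K₁', K₂'))ʲ` the isomorphism is `η ≫ H(ι)`.
[cite: Weibel1994, §1.2, 1.2.6] -/
@[reassoc]
theorem ιMapBifunctor_mapBifunctorIsoOfComponents_hom (i₁ : I₁) (i₂ : I₂) (j : J) (h : ComplexShape.π c₁ c₂ c (i₁, i₂) = j) :
    HomologicalComplex.ιMapBifunctor K₁' K₂' F' c i₁ i₂ j h ≫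
        (mapBifunctorIsoOfComponents K₁ K₂ K₁' K₂' F F' H η hη₁ hη₂ c).hom.f j =
      (η i₁ i₂).hom ≫ H.map (HomologicalComplex.ιMapBifunctor K₁ K₂ F c i₁ i₂ j h) := by
  haveI := hasTotal_mapBicomplex_of_components K₁ K₂ K₁' K₂' F F' H η hη₁ hη₂ c
  rw [mapBifunctorIsoOfComponents, Iso.trans_hom, HomologicalComplex.comp_f, HomologicalComplex₂.total.mapIso_hom,
    HomologicalComplex₂.ιTotal_map_assoc, ιTotal_mapTotalIso_hom, mapBifunctorHomologicalComplexIsoOfComponents_hom_f_f]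

end Literature.Algebra.Homology

end
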